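import Summits.HodgeConjecture.HodgeConjecture.Theorems.LimitExtensionHypersurfacesSufficeOfLE
import Summits.HodgeConjecture.HodgeConjecture.Theorems.LimitExtensionMiddleDivisorSupportSuffices
import Summits.HodgeConjecture.HodgeConjecture.Theses.NodalSupport
import Literature.AlgebraicGeometry.HodgeTheory.GysinKernelSplit
import Literature.AlgebraicGeometry.HodgeTheory.HodgeRiemannPolarizability
import Literature.AlgebraicGeometry.HodgeTheory.ComplexConjugationHolds
import Literature.NumberTheory.Transcendental.DeRhamTheoremMultiplicative

/-!
# Route LimitExtension — `Assembly` (item stmt-HodgeConjecture-10868): the residue pinned to ledger objects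

After the review-split of 2026-08-16 the named Literature leaf
`deCataldoMigliorini2009_mem_algebraicClasses_of_two_mul_le` (the Lefschetz-pencil step below the
middle) is MERGED BACK into its consumers as an explicit hypothesis, to be supplied by the closing
theorem of the sibling support item stmt-HodgeConjecture-1083
(`Summit.HodgeConjecture.HodgeConjecture.Theses.NodalSupport.PencilReduction`), and the module
`Literature/AlgebraicGeometry/HodgeTheory/PencilStepBelowMiddle` is to be deleted together with its
importer `Theorems/LimitExtensionAssemblyNamedLeaves`.  This file restates the residue of the
assembly item WITHOUT that module, every hypothesis being literally a ledger object — a named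
Literature fact or the route decl of an open statement item — so that the closing theorems plug in
with no glue:

* `limitExtension_assembly_of_divisorInduction_of_pencilReduction` — `Assembly` from the route
  decls of stmt-HodgeConjecture-1082 (`NodalSupport.DivisorInduction`), stmt-HodgeConjecture-1083
  (`NodalSupport.PencilReduction`) and stmt-HodgeConjecture-2998 (`SpecialisationOfAlgebraicity`):
  the planner's `fun m a b ↦ h₈ m (h₇ a b)` with `h₈ = middleDivisorSupportSuffices_of_nodalSupport`
  and `h₇ = limitExtension_pullbackGlue_of_specialisation`;
* `limitExtension_assembly_of_fourLeaves` — `Assembly` from the two named facts behind the divisor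
  induction (Deligne *Hodge III* Prop. 8.2.7, `Deligne1974_ker_pullback_eq_ker_pullback_resolution`;
  polarizability, `smoothProjective_hodgeStructure_isPolarizable`), stmt-HodgeConjecture-2998 and
  stmt-HodgeConjecture-1083 — the term of the tree's `limitExtension_assembly_of_leaves_of_pencilReduction`
  (`Theorems/LimitExtensionAssemblyLeaves`) with its verbatim pencil hypothesis typed as the route
  decl: Prop. 8.2.7 ⟹ Cor. 8.2.8 (`Deligne1974_ker_restrictCompl_eq_iSup_range_complexGysin_holds_of`),
  polarizability ⟹ Voisin 2025 Cor. 2.12 (`Voisin2025_hodgeClass_lift_complexGysin_holds_of` with the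
  theorems `exists_isReal_hodgeModel_holds`, `exists_deRhamIsoFamily_holds`), then
  `middleDivisorSupportSuffices_of_facts` and `limitExtension_pullbackGlue_of_specialisation`.

STATUS: CONDITIONAL (supports the item, does not close it).  CLOSING RECIPE: once
`h827_holds : Deligne1974_ker_pullback_eq_ker_pullback_resolution`,
`hpol_holds : smoothProjective_hodgeStructure_isPolarizable`, `spec_proof : SpecialisationOfAlgebraicity`
(stmt-HodgeConjecture-2998) and `pen_proof : NodalSupport.PencilReduction` (stmt-HodgeConjecture-1083)
are theorems, `theorem limitExtension_assembly_proof : Assembly :=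
limitExtension_assembly_of_fourLeaves h827_holds hpol_holds spec_proof pen_proof`
(`--workitem stmt-HodgeConjecture-10868`); equivalently `limitExtension_assembly_of
(limitExtension_pullbackGlue_of_specialisation spec_proof) middleDivisorSupportSuffices_proof` once
stmt-HodgeConjecture-10865 closes.

## References

* [Thomas2005Nodes] R. P. Thomas, Nodes and the Hodge conjecture, J. Algebraic Geom. 14 (2005),
  Prop. 2 and its proof.
* [DeligneHodgeIII1974] P. Deligne, Théorie de Hodge III, Publ. Math. IHÉS 44 (1974), Prop. 8.2.7,
  Cor. 8.2.8.
* [Voisin2025] C. Voisin, J. Open Math. Probl. 1 (2025), Cor. 2.12.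
* [Fulton1998] W. Fulton, Intersection Theory, §10.1, §19.1, §20.3.
-/

-- `Summit.HodgeConjecture.HodgeConjecture.Theorems` is the mandated namespace (single-conjunct summit:
-- Sub = Summit), which `linter.dupNamespace` flags on every declaration; the lakefile turns the
-- linter off tree-wide (weak option), restated here so stand-alone elaboration is warning-free too.
set_option linter.dupNamespace false

noncomputable section

namespace Summit.HodgeConjecture.HodgeConjecture.Theorems

open Summit.HodgeConjecture.HodgeConjecture.Theses.LimitExtension
open Literature.AlgebraicGeometry.HodgeTheory Literature.AlgebraicGeometry.Motives

/-- **`Assembly` from three statement items, by their route decls.**  The divisor induction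
`NodalSupport.DivisorInduction` (stmt-HodgeConjecture-1082) and the pencil step
`NodalSupport.PencilReduction` (stmt-HodgeConjecture-1083) give `MiddleDivisorSupportSuffices`
(`middleDivisorSupportSuffices_of_nodalSupport`, Thomas's induction on the dimension); the
specialisation lemma `SpecialisationOfAlgebraicity` (stmt-HodgeConjecture-2998) gives `PullbackGlue`
(`limitExtension_pullbackGlue_of_specialisation`); compose as `fun m a b ↦ h₈ m (h₇ a b)`.
CONDITIONAL on the three items. [cite: Thomas2005Nodes, Prop. 2 (proof)] -/
theorem limitExtension_assembly_of_divisorInduction_of_pencilReduction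
    (hDI : Summit.HodgeConjecture.HodgeConjecture.Theses.NodalSupport.DivisorInduction)
    (hPen : Summit.HodgeConjecture.HodgeConjecture.Theses.NodalSupport.PencilReduction)
    (hS : SpecialisationOfAlgebraicity) : Assembly :=
  fun hM a b ↦ middleDivisorSupportSuffices_of_nodalSupport hDI hPen hM
    (limitExtension_pullbackGlue_of_specialisation hS a b)

/-- **`Assembly` from the four leaves**: Deligne *Hodge III* Prop. 8.2.7 (`h827`), the
polarizability of the Hodge structure of a smooth projective variety (`hpol`), the route's
specialisation lemma (`hS`, stmt-HodgeConjecture-2998) and the sibling route's pencil step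
(`hPen`, stmt-HodgeConjecture-1083, the route decl `NodalSupport.PencilReduction`, definitionally the
verbatim pencil hypothesis of `middleDivisorSupportSuffices_of_facts`): Prop. 8.2.7 gives Cor. 8.2.8,
polarizability gives Voisin's Hodge-class lift along Gysin sums, the two feed Thomas's induction
`middleDivisorSupportSuffices_of_facts` together with `hPen`, and `hS` gives `PullbackGlue`.
CONDITIONAL on the two named facts and the two items; this is the item's closing term once they
are theorems.
[cite: DeligneHodgeIII1974, Prop. 8.2.7 and Cor. 8.2.8] [cite: Voisin2025, Cor. 2.12]
[cite: Thomas2005Nodes, Prop. 2 (proof)] -/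
theorem limitExtension_assembly_of_fourLeaves
    (h827 : Deligne1974_ker_pullback_eq_ker_pullback_resolution)
    (hpol : smoothProjective_hodgeStructure_isPolarizable)
    (hS : SpecialisationOfAlgebraicity)
    (hPen : Summit.HodgeConjecture.HodgeConjecture.Theses.NodalSupport.PencilReduction) :
    Assembly :=
  fun hM a b ↦ middleDivisorSupportSuffices_of_facts
    (Deligne1974_ker_restrictCompl_eq_iSup_range_complexGysin_holds_of h827)
    (Voisin2025_hodgeClass_lift_complexGysin_holds_of exists_isReal_hodgeModel_holds
      (fun E _ _ _ ↦ Literature.NumberTheory.Transcendental.exists_deRhamIsoFamily_holds E) hpol)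
    hPen hM (limitExtension_pullbackGlue_of_specialisation hS a b)

end Summit.HodgeConjecture.HodgeConjecture.Theorems

end
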